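import Summits.Langlands.Langlands.Theorems.IrreducibilityBySelfDualityReciprocityUpToIrreducibilityRamifiedPlaces
import Summits.Langlands.Langlands.Theorems.IrreducibilityBySelfDualityReciprocityUpToIrreducibilityAboveUnramified
import Literature.NumberTheory.GaloisRepresentations.ArtinRestriction
import HarnessLib

/-!
# Line `Sketch` for the crux `ReciprocityUpToIrreducibility` (item stmt-Langlands-14328), continuation c8:
# the summit's `Corresponds` on the ARTIN SECTOR is the classical local matching at every place

Support file (closes nothing; `--supports stmt-Langlands-14328`).  For a reciprocity datum `Rec`, a prime `ℓ`,
`ι : ℚ̄_ℓ ≃ ℂ`, an automorphic `π` of `GL_n(𝔸_K)` and a Galois representation `ρ : Γ_K → GL_n(ℚ̄_ℓ)` of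
ARTIN TYPE (open kernel, e.g. the `ℓ`-adic avatar of an Artin representation) which is unramified at the
places above `ℓ` (the residue B1 of the line: off that sector the pinned Fontaine datum decides nothing), the
summit's predicate `Corresponds Rec ι π ρ` — Satake–Frobenius matching almost everywhere AND the local–global
clause `LocalGlobalCompatibleAt` at EVERY finite place, the latter phrased through the Grothendieck–Deligne
recipe at `v ∤ ℓ` and through Fontaine's pinned `D_pst` datum at `v ∣ ℓ` — is EQUIVALENT to the `ℓ`-blind
classical statement: Satake–Frobenius matching almost everywhere and, at every finite `v`, some local component
`π_v` of `π` with `rec_v(π_v) = [ι(ρ|_{W_{K_v}}, N = 0)^{F-ss}]` (`corresponds_iff_localMatching_of_isOpen_ker`).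
The two halves are the line's earlier sector theorems: at `v ∤ ℓ` the finite-inertia form of the clause
(`localGlobalCompatibleAt_away_iff_of_isContinuousRep`, c7, every rank), at `v ∣ ℓ` the unramified form under
`FontaineDatumExists` (`localGlobalCompatibleAt_above_iff_of_isUnramifiedAt`, c3, clause (F8) of the pinned
datum).  Such a `ρ` is automatically geometric for the pinned datum (`isGeometricFramed_of_isOpen_ker`:
unramified almost everywhere by `FramedGaloisRep.eventually_isUnramifiedAt_of_isOpen_ker`, de Rham above `ℓ`
because unramified there).  Consequently direction (B) of the summit restricted to the Artin sector
(irreducible `ρ` of Artin type unramified above `ℓ`) reads, for every `Rec`, as the strong Artin conjecture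
with full local matching (`galoisToAutomorphic_artinSector_iff`), and direction (A) at a `π` whose avatar is of
Artin type likewise (`automorphicToGalois_artinSector_of_localMatching`).  No definitions; std axioms.
-/

noncomputable section

set_option linter.dupNamespace false -- project-wide option (lakefile weak.linter.dupNamespace); `Summit.Langlands.Langlands` is the mandated namespace

open scoped MatrixGroups Matrix NumberField Classical
open Filter IsDedekindDomain Field
open Literature.NumberTheory.Automorphic Literature.NumberTheory.GaloisRepresentations
open Literature.NumberTheory.PAdicHodge
open Summit.Langlands

namespace Summit.Langlands.Langlands.Theorems.ReciprocityUpToIrreducibility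

variable {K : Type} [Field K] [NumberField K] {ℓ : ℕ} [Fact ℓ.Prime] {n : ℕ}
  {hcpt : isCompact_glFiniteIntegralLevel n K}

/-- **At every finite place, for `ρ` of Artin type unramified above `ℓ`, the summit's local–global clause is
the `ℓ`-blind local matching** `∃ π_v rℂ, π_v local component of π ∧ rℂ = ι(ρ|_{W_{K_v}}, 0) ∧ rℂ^{F-ss} ∈ rec_v(π_v)`
(case split `ℓ ∈ v` / `ℓ ∉ v` over the line's two sector theorems; the Weil–Deligne representation
`(ρ|_{W_{K_v}}, 0)` does not depend on the continuity witness). [cite: TateCorvallis1979, (4.1.3)–(4.2.1)]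
[cite: DeligneAntwerpII1973, §8.4.2] [cite: FontaineAsterisque223VIII, §1.3 and §2.3.7] -/
theorem localGlobalCompatibleAt_iff_localMatching_of_isOpen_ker (hF : FontaineDatumExists)
    (Rec : ReciprocityData K) (ι : PadicAlgCl ℓ ≃+* ℂ)
    (π : AutomorphicRepData (AutomorphyDatum.gl n K hcpt)) (ρ : FramedGaloisRep K (PadicAlgCl ℓ) n)
    (hker : IsOpen (ρ.toMonoidHom.ker : Set (absoluteGaloisGroup K)))
    (hρℓ : ∀ v : HeightOneSpectrum (𝓞 K), ((ℓ : ℕ) : 𝓞 K) ∈ v.asIdeal → ρ.IsUnramifiedAt v)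
    (v : HeightOneSpectrum (𝓞 K)) :
    LocalGlobalCompatibleAt Rec ι π ρ v ↔
      ∃ (πv : SmoothIrrep (GL (Fin n) (v.adicCompletion K)))
        (rℂ : WeilDeligneRep (v.adicCompletion K) ℂ (Fin n → ℂ)),
        π.HasLocalComponentAt v πv.ρ ∧
          (WeilDeligneRep.ofRep ((ρ.toLocal v).weilRestrict (v.adicCompletion K))
            (isContinuousRep_weilRestrict_toLocal_of_isOpen_ker ρ hker v)).IsTransportAlong
              (ι : PadicAlgCl ℓ →+* ℂ) rℂ ∧
          rℂ.HasFrobSemisimpleClass ((Rec.llc v).recGL n (IrrClass.mk πv)) := by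
  by_cases hv : ((ℓ : ℕ) : 𝓞 K) ∈ v.asIdeal
  · exact localGlobalCompatibleAt_above_iff_of_isUnramifiedAt hF Rec ι π ρ hv (hρℓ v hv)
  · exact localGlobalCompatibleAt_away_iff_of_isContinuousRep Rec ι π ρ hv
      (isContinuousRep_weilRestrict_toLocal_of_isOpen_ker ρ hker v)

/-- **`Corresponds` on the Artin sector = Satake–Frobenius matching a.e. + the classical local matching at
EVERY finite place** (every rank, every `Rec`, under `FontaineDatumExists`; `ρ` of Artin type unramified above
`ℓ`). [cite: BuzzardGeeLMS2014, Conj. 3.2.1–3.2.2] [cite: HarrisTaylorAMS2001, Thm. A] -/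
theorem corresponds_iff_localMatching_of_isOpen_ker (hF : FontaineDatumExists)
    (Rec : ReciprocityData K) (ι : PadicAlgCl ℓ ≃+* ℂ)
    (π : AutomorphicRepData (AutomorphyDatum.gl n K hcpt)) (ρ : FramedGaloisRep K (PadicAlgCl ℓ) n)
    (hker : IsOpen (ρ.toMonoidHom.ker : Set (absoluteGaloisGroup K)))
    (hρℓ : ∀ v : HeightOneSpectrum (𝓞 K), ((ℓ : ℕ) : 𝓞 K) ∈ v.asIdeal → ρ.IsUnramifiedAt v) :
    Corresponds Rec ι π ρ ↔
      (∀ᶠ v : HeightOneSpectrum (𝓞 K) in cofinite, SatakeFrobCompatibleAt ι π ρ v) ∧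
      ∀ v : HeightOneSpectrum (𝓞 K),
        ∃ (πv : SmoothIrrep (GL (Fin n) (v.adicCompletion K)))
          (rℂ : WeilDeligneRep (v.adicCompletion K) ℂ (Fin n → ℂ)),
          π.HasLocalComponentAt v πv.ρ ∧
            (WeilDeligneRep.ofRep ((ρ.toLocal v).weilRestrict (v.adicCompletion K))
              (isContinuousRep_weilRestrict_toLocal_of_isOpen_ker ρ hker v)).IsTransportAlong
                (ι : PadicAlgCl ℓ →+* ℂ) rℂ ∧
            rℂ.HasFrobSemisimpleClass ((Rec.llc v).recGL n (IrrClass.mk πv)) :=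
  and_congr_right fun _ =>
    forall_congr' fun v => localGlobalCompatibleAt_iff_localMatching_of_isOpen_ker hF Rec ι π ρ hker hρℓ v

/-- **Registered stub of the skeleton `Lines/Sketch.lean` §1n (c8): `Corresponds` on the Artin sector is the
classical local matching** — the registered name for `corresponds_iff_localMatching_of_isOpen_ker`.
[cite: BuzzardGeeLMS2014, Conj. 3.2.1–3.2.2] [cite: HarrisTaylorAMS2001, Thm. A] -/
theorem stub_corresponds_iff_localMatching_of_isOpen_ker :
    FontaineDatumExists → ∀ (K : Type) [Field K] [NumberField K] (ℓ : ℕ) [Fact ℓ.Prime] (n : ℕ)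
      (hcpt : isCompact_glFiniteIntegralLevel n K) (Rec : ReciprocityData K) (ι : PadicAlgCl ℓ ≃+* ℂ)
      (π : AutomorphicRepData (AutomorphyDatum.gl n K hcpt)) (ρ : FramedGaloisRep K (PadicAlgCl ℓ) n)
      (hker : IsOpen (ρ.toMonoidHom.ker : Set (Field.absoluteGaloisGroup K))),
      (∀ v : HeightOneSpectrum (𝓞 K), ((ℓ : ℕ) : 𝓞 K) ∈ v.asIdeal → ρ.IsUnramifiedAt v) →
      (Corresponds Rec ι π ρ ↔
        (∀ᶠ v : HeightOneSpectrum (𝓞 K) in cofinite, SatakeFrobCompatibleAt ι π ρ v) ∧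
        ∀ v : HeightOneSpectrum (𝓞 K),
          ∃ (πv : SmoothIrrep (GL (Fin n) (v.adicCompletion K)))
            (rℂ : WeilDeligneRep (v.adicCompletion K) ℂ (Fin n → ℂ)),
            π.HasLocalComponentAt v πv.ρ ∧
              (WeilDeligneRep.ofRep ((ρ.toLocal v).weilRestrict (v.adicCompletion K))
                (isContinuousRep_weilRestrict_toLocal_of_isOpen_ker ρ hker v)).IsTransportAlong
                  (ι : PadicAlgCl ℓ →+* ℂ) rℂ ∧
              rℂ.HasFrobSemisimpleClass ((Rec.llc v).recGL n (IrrClass.mk πv))) :=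
  fun hF _ _ _ _ _ _ _ Rec ι π ρ hker hρℓ => corresponds_iff_localMatching_of_isOpen_ker hF Rec ι π ρ hker hρℓ

/-- **An Artin-type `ρ` unramified above `ℓ` is geometric for the pinned datum** (every `Rec`): unramified at
all but finitely many places because its kernel is open (`FramedGaloisRep.eventually_isUnramifiedAt_of_isOpen_ker`:
the finite extension cut out by the kernel is unramified outside the different), and de Rham at every `v ∣ ℓ`
because unramified there (structure axiom of every `PstWeilDeligneData`).
[cite: FontaineMazurGeometric1995, §1] [cite: FontaineAsterisque223III, §5] -/
theorem isGeometricFramed_of_isOpen_ker (Rec : ReciprocityData K) (ρ : FramedGaloisRep K (PadicAlgCl ℓ) n)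
    (hker : IsOpen (ρ.toMonoidHom.ker : Set (absoluteGaloisGroup K)))
    (hρℓ : ∀ v : HeightOneSpectrum (𝓞 K), ((ℓ : ℕ) : 𝓞 K) ∈ v.asIdeal → ρ.IsUnramifiedAt v) :
    IsGeometricFramed Rec ρ :=
  ⟨ρ.eventually_isUnramifiedAt_of_isOpen_ker hker, fun v hv =>
    (Rec.pst ℓ v hv).isDeRhamFramed_of_isLocallyUnramified
      (isLocallyUnramified_toLocal_of_isUnramifiedAt ρ v (hρℓ v hv))⟩

/-- **Direction (B) of the summit on the Artin sector, read classically** (every rank `n`, every `Rec`, under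
`FontaineDatumExists`): "every irreducible `ρ : Γ_K → GL_n(ℚ̄_ℓ)` of Artin type unramified above `ℓ` corresponds
(`Corresponds Rec ι`) to some L-algebraic cuspidal `π`" holds iff "every such `ρ` has an L-algebraic cuspidal `π`
with Satake–Frobenius matching a.e. and `rec_v(π_v) = [ι(ρ|_{W_{K_v}}, 0)^{F-ss}]` at every finite `v`" — the
strong Artin conjecture with full local matching, transported to `ℚ̄_ℓ` (geometricity is automatic,
`isGeometricFramed_of_isOpen_ker`). [cite: BuzzardGeeLMS2014, Conj. 3.2.2 and §5] [cite: FontaineMazurGeometric1995, Conj. 1] -/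
theorem galoisToAutomorphic_artinSector_iff (hF : FontaineDatumExists) (hcpt : isCompact_glFiniteIntegralLevel n K)
    (Rec : ReciprocityData K) (ι : PadicAlgCl ℓ ≃+* ℂ) :
    (∀ ρ : FramedGaloisRep K (PadicAlgCl ℓ) n, (hker : IsOpen (ρ.toMonoidHom.ker : Set (absoluteGaloisGroup K))) →
      (∀ v : HeightOneSpectrum (𝓞 K), ((ℓ : ℕ) : 𝓞 K) ∈ v.asIdeal → ρ.IsUnramifiedAt v) →
      ρ.toGaloisRep.IsIrreducible →
        ∃ π : CuspidalAutomorphicRepData n K hcpt, π.1.IsLAlgebraic ∧ Corresponds Rec ι π.1 ρ) ↔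
    (∀ ρ : FramedGaloisRep K (PadicAlgCl ℓ) n, (hker : IsOpen (ρ.toMonoidHom.ker : Set (absoluteGaloisGroup K))) →
      (∀ v : HeightOneSpectrum (𝓞 K), ((ℓ : ℕ) : 𝓞 K) ∈ v.asIdeal → ρ.IsUnramifiedAt v) →
      ρ.toGaloisRep.IsIrreducible →
        ∃ π : CuspidalAutomorphicRepData n K hcpt, π.1.IsLAlgebraic ∧
          (∀ᶠ v : HeightOneSpectrum (𝓞 K) in cofinite, SatakeFrobCompatibleAt ι π.1 ρ v) ∧
          ∀ v : HeightOneSpectrum (𝓞 K),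
            ∃ (πv : SmoothIrrep (GL (Fin n) (v.adicCompletion K)))
              (rℂ : WeilDeligneRep (v.adicCompletion K) ℂ (Fin n → ℂ)),
              π.1.HasLocalComponentAt v πv.ρ ∧
                (WeilDeligneRep.ofRep ((ρ.toLocal v).weilRestrict (v.adicCompletion K))
                  (isContinuousRep_weilRestrict_toLocal_of_isOpen_ker ρ hker v)).IsTransportAlong
                    (ι : PadicAlgCl ℓ →+* ℂ) rℂ ∧
                rℂ.HasFrobSemisimpleClass ((Rec.llc v).recGL n (IrrClass.mk πv))) := by
  refine forall_congr' fun ρ => forall_congr' fun hker => forall_congr' fun hρℓ =>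
    forall_congr' fun _ => exists_congr fun π => and_congr_right fun _ => ?_
  exact corresponds_iff_localMatching_of_isOpen_ker hF Rec ι π.1 ρ hker hρℓ

/-- **The summit's (B) supplies the Artin sector**: `GaloisToAutomorphic n Rec hcpt` gives, for every irreducible
Artin-type `ρ` unramified above `ℓ`, an L-algebraic cuspidal `π` with Satake matching a.e. and the classical local
matching at every finite place. [cite: FontaineMazurGeometric1995, Conj. 1] [cite: BuzzardGeeLMS2014, Conj. 3.2.2] -/
theorem artinSector_of_galoisToAutomorphic (hF : FontaineDatumExists) {hcpt : isCompact_glFiniteIntegralLevel n K}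
    {Rec : ReciprocityData K} (hB : GaloisToAutomorphic n Rec hcpt) (ι : PadicAlgCl ℓ ≃+* ℂ)
    (ρ : FramedGaloisRep K (PadicAlgCl ℓ) n) (hker : IsOpen (ρ.toMonoidHom.ker : Set (absoluteGaloisGroup K)))
    (hρℓ : ∀ v : HeightOneSpectrum (𝓞 K), ((ℓ : ℕ) : 𝓞 K) ∈ v.asIdeal → ρ.IsUnramifiedAt v)
    (hirr : ρ.toGaloisRep.IsIrreducible) :
    ∃ π : CuspidalAutomorphicRepData n K hcpt, π.1.IsLAlgebraic ∧
      (∀ᶠ v : HeightOneSpectrum (𝓞 K) in cofinite, SatakeFrobCompatibleAt ι π.1 ρ v) ∧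
      ∀ v : HeightOneSpectrum (𝓞 K),
        ∃ (πv : SmoothIrrep (GL (Fin n) (v.adicCompletion K)))
          (rℂ : WeilDeligneRep (v.adicCompletion K) ℂ (Fin n → ℂ)),
          π.1.HasLocalComponentAt v πv.ρ ∧
            (WeilDeligneRep.ofRep ((ρ.toLocal v).weilRestrict (v.adicCompletion K))
              (isContinuousRep_weilRestrict_toLocal_of_isOpen_ker ρ hker v)).IsTransportAlong
                (ι : PadicAlgCl ℓ →+* ℂ) rℂ ∧
            rℂ.HasFrobSemisimpleClass ((Rec.llc v).recGL n (IrrClass.mk πv)) := by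
  obtain ⟨π, hL, hcorr⟩ := hB ℓ ι ρ hirr (isGeometricFramed_of_isOpen_ker Rec ρ hker hρℓ)
  exact ⟨π, hL, (corresponds_iff_localMatching_of_isOpen_ker hF Rec ι π.1 ρ hker hρℓ).mp hcorr⟩

/-- **Direction (A) on the Artin sector from the classical data**: if an Artin-type `ρ` unramified above `ℓ`
matches `π` (Satake a.e. + classical local matching at every place) then it is a geometric correspondent of `π`
in the summit's sense, and every other correspondent of `π` is conjugate to it as soon as `ρ` is irreducible
(Chebotarev + Brauer–Nesbitt, `isConjugate_of_satakeFrobCompatibleAt`, c2).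
[cite: BuzzardGeeLMS2014, Conj. 3.2.1–3.2.2] [cite: HarrisTaylorAMS2001, Thm. A] -/
theorem automorphicToGalois_artinSector_of_localMatching (hF : FontaineDatumExists)
    (Rec : ReciprocityData K) (ι : PadicAlgCl ℓ ≃+* ℂ)
    (π : AutomorphicRepData (AutomorphyDatum.gl n K hcpt)) (ρ : FramedGaloisRep K (PadicAlgCl ℓ) n)
    (hker : IsOpen (ρ.toMonoidHom.ker : Set (absoluteGaloisGroup K)))
    (hρℓ : ∀ v : HeightOneSpectrum (𝓞 K), ((ℓ : ℕ) : 𝓞 K) ∈ v.asIdeal → ρ.IsUnramifiedAt v)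
    (hirr : ρ.toGaloisRep.IsIrreducible)
    (hae : ∀ᶠ v : HeightOneSpectrum (𝓞 K) in cofinite, SatakeFrobCompatibleAt ι π ρ v)
    (hloc : ∀ v : HeightOneSpectrum (𝓞 K),
      ∃ (πv : SmoothIrrep (GL (Fin n) (v.adicCompletion K)))
        (rℂ : WeilDeligneRep (v.adicCompletion K) ℂ (Fin n → ℂ)),
        π.HasLocalComponentAt v πv.ρ ∧
          (WeilDeligneRep.ofRep ((ρ.toLocal v).weilRestrict (v.adicCompletion K))
            (isContinuousRep_weilRestrict_toLocal_of_isOpen_ker ρ hker v)).IsTransportAlong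
              (ι : PadicAlgCl ℓ →+* ℂ) rℂ ∧
          rℂ.HasFrobSemisimpleClass ((Rec.llc v).recGL n (IrrClass.mk πv))) :
    ρ.toGaloisRep.IsIrreducible ∧ IsGeometricFramed Rec ρ ∧ Corresponds Rec ι π ρ ∧
      ∀ ρ' : FramedGaloisRep K (PadicAlgCl ℓ) n, Corresponds Rec ι π ρ' → IsConjugate ρ ρ' :=
  ⟨hirr, isGeometricFramed_of_isOpen_ker Rec ρ hker hρℓ,
    (corresponds_iff_localMatching_of_isOpen_ker hF Rec ι π ρ hker hρℓ).mpr ⟨hae, hloc⟩,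
    fun _ hρ' => isConjugate_of_satakeFrobCompatibleAt π ι hirr hae hρ'.1⟩

end Summit.Langlands.Langlands.Theorems.ReciprocityUpToIrreducibility

end
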